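import Summits.QuantumFields.YangMills.Theorems.SwapVirialDeficitSectorLaplaceEndGaussN2
import Summits.QuantumFields.YangMills.Theorems.SwapVirialDeficitSectorLaplaceEndGaussLocalize
import Summits.QuantumFields.YangMills.Theorems.SwapVirialDeficitSectorLaplaceSetIntegralOfLintegral
import HarnessLib

/-!
# N2 FOR THE ACTUAL INTEGRAND `𝟙_{G♭}·e^{−bF̂}` — discharging `hgle`∕`hgcore` of ✓`endGauss_N2_glue` (memo-ε plug, step 0)
# (free-hands support of ⟨stmt-QuantumFields-24197⟩ `SwapVirialDeficit.SwapGluedStiffness`; LEAD g99)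

✓`endGauss_N2_glue` takes the integrand `g` abstractly with two hypotheses.  For the integrand of `stub_end_gaussCore`,
`g = 𝟙_{G♭(τ)}·ofReal(e^{−b·F̂(hubAt δ 1, ε, η)})` (`G♭` = the Gaussian core of ✓`stub_core_end_of_gaussCore`, `X₁ = 1`), both hold:
`gaussCoreIntegrand_le` (w3 ✓`indicator_ofReal_exp_le`) and ★ `gaussCoreIntegrand_core` (a non-vanishing point lies in `G♭`, whence `δ² ≤ 1/3`, the Gaussian half, and
the localisation alternative `|u|² < τ² ∨ 12τ² ≤ B₀` by w3 ✓`endGaussCore_sq_le` ∕ ✓`endGaussCore_B0_ge`).  ★★ `endGauss_N2_gaussCore` = ✓`endGauss_N2_glue` for this `g`.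

HONEST LABEL: bookkeeping; the memo-ε plug of `stub_end_gaussCore`, `stub_core_tip`, ⟨24197⟩ ∕ ⟨24194⟩ OPEN; own crux ⟨22884⟩ OPEN (blocked-on ⟨19935⟩); the Yang–Mills mass gap is
NOT proved; no summit is proved by a line.  THEOREMS ONLY (0 `def`, 0 `sorry`, no instance), standard axioms.  LEAD seat ym-line-sfw-p2 g99, `--supports stmt-QuantumFields-24197`.
References: [folklore].
-/

set_option autoImplicit false
set_option synthInstance.maxSize 1024

noncomputable section

open MeasureTheory Quaternion Set Module
open scoped Quaternion BigOperators ENNReal InnerProductSpace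
open Literature.MathematicalPhysics.QuantumLattice
open Literature.MathematicalPhysics.QuantumFieldTheory hiding SU2

namespace Summit.QuantumFields.YangMills.Theorems.SwapVirialDeficit.SectorLaplace

open Summit.QuantumFields.YangMills.Theorems.FemtoTransferGap
open Summit.QuantumFields.YangMills.Theorems.FemtoTransferGap.TT
open Summit.QuantumFields.YangMills.Theorems.VirialFluxGap.RingDeficit
open Summit.QuantumFields.YangMills.Theorems.SwapVirialDeficit.SwapRing
open Summit.QuantumFields.YangMills.Theorems.SwapVirialDeficit.BlowUpRing
open Summit.QuantumFields.YangMills.Theorems.SwapVirialDeficit.SigmaBall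
open Summit.QuantumFields.YangMills.Theorems.SwapVirialDeficit.Gnomonic (gnomonicWeight piWeight normSq3)

variable {L : ℕ} [NeZero L]

/-- ★ **A NON-VANISHING POINT OF `𝟙_{G♭}·e^{−bF̂}` LIES IN THE GAUSSIAN CORE**, whence the three facts ✓`endGauss_N2_glue` asks for (`hgcore`):
`(t 0)² ≤ 1/3`, `|u|² ≤ 1 + (t 1)²`, and `|u|² < τ² ∨ 12τ² ≤ B₀(t 0, t 1, t 2)`. [folklore] -/
theorem gaussCoreIntegrand_core {τ : ℝ} (hτ : 0 < τ) (hτ2 : τ ≤ 1 / 2) (b : ℝ) (ε : GnoSign L)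
    (u : ℝ × ℝ) (t : Fin 3 → ℝ) (v : Fin 2 → ℝ) (z : Fin 3 → ℝ)
    (h : ∃ F : Fol L → Fin 3 → ℝ,
      ({p : ℝ × GnoCoord L | 4 * p.1 ^ 2 / (1 + p.1 ^ 2) ^ 2 < τ ∧ τ ≤ (1 + p.1 ^ 2)⁻¹} \
            ({p : ℝ × GnoCoord L | 4 * p.1 ^ 2 / (1 + p.1 ^ 2) ^ 2 < τ ∧ τ ≤ (1 + p.1 ^ 2)⁻¹ ∧ |p.1| < τ * Real.sqrt (1 + p.1 ^ 2)} ∩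
              {p : ℝ × GnoCoord L | τ ≤ Real.sqrt (p.2.1.1 1 ^ 2 + p.2.1.1 2 ^ 2)} ∩
              {p : ℝ × GnoCoord L | |p.2.1.1 0| ≤ 1 * Real.sqrt (1 + p.2.1.1 1 ^ 2 + p.2.1.1 2 ^ 2)}) ∩
          {p : ℝ × GnoCoord L | p.2.1.1 1 ^ 2 + p.2.1.1 2 ^ 2 ≤ 1 + p.2.1.1 0 ^ 2}).indicator
        (fun q : ℝ × GnoCoord L => ENNReal.ofReal (Real.exp (-(b * gnoDeficit (fun _ => false) (fun _ => 1) (hubAt q.1 1) ε q.2))))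
        (t 0, ((((![t 1, u.1, u.2] : Fin 3 → ℝ), (![t 2, v 0, v 1] : Fin 3 → ℝ)), (z, F)) : GnoCoord L)) ≠ 0) :
    (t 0) ^ 2 ≤ 1 / 3 ∧ u.1 ^ 2 + u.2 ^ 2 ≤ 1 + (t 1) ^ 2 ∧
      (u.1 ^ 2 + u.2 ^ 2 < τ ^ 2 ∨ 12 * τ ^ 2 ≤ 16 * (t 0) ^ 2 / (1 + (t 0) ^ 2) + 8 * (t 1) ^ 2 / ((1 + (t 1) ^ 2) * (1 + (t 0) ^ 2)) + 4 * (t 2) ^ 2 / (1 + (t 2) ^ 2)) := by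
  obtain ⟨F, hF⟩ := h
  have hmem := Set.mem_of_indicator_ne_zero hF
  obtain ⟨-, hδ3, hu⟩ := endGaussCore_sq_le (L := L) hmem
  have hu' : u.1 ^ 2 + u.2 ^ 2 ≤ 1 + (t 1) ^ 2 := by simpa using hu
  refine ⟨hδ3, hu', ?_⟩
  by_cases hcut : τ ≤ Real.sqrt (u.1 ^ 2 + u.2 ^ 2)
  · right
    have hB := endGaussCore_B0_ge (L := L) hτ hτ2 le_rfl hmem (by simpa using hcut)
    simpa using hB
  · left
    have hlt : Real.sqrt (u.1 ^ 2 + u.2 ^ 2) < τ := not_le.1 hcut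
    exact (Real.sqrt_lt' hτ).1 hlt

/-- `𝟙_{G♭}·e^{−bF̂} ≤ e^{−bF̂}` pointwise on the fibre (✓`indicator_ofReal_exp_le`). [folklore] -/
theorem gaussCoreIntegrand_le {τ : ℝ} (b : ℝ) (ε : GnoSign L) (u : ℝ × ℝ) (t : Fin 3 → ℝ) (v : Fin 2 → ℝ) (z : Fin 3 → ℝ) (F : Fol L → Fin 3 → ℝ) :
    ({p : ℝ × GnoCoord L | 4 * p.1 ^ 2 / (1 + p.1 ^ 2) ^ 2 < τ ∧ τ ≤ (1 + p.1 ^ 2)⁻¹} \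
            ({p : ℝ × GnoCoord L | 4 * p.1 ^ 2 / (1 + p.1 ^ 2) ^ 2 < τ ∧ τ ≤ (1 + p.1 ^ 2)⁻¹ ∧ |p.1| < τ * Real.sqrt (1 + p.1 ^ 2)} ∩
              {p : ℝ × GnoCoord L | τ ≤ Real.sqrt (p.2.1.1 1 ^ 2 + p.2.1.1 2 ^ 2)} ∩
              {p : ℝ × GnoCoord L | |p.2.1.1 0| ≤ 1 * Real.sqrt (1 + p.2.1.1 1 ^ 2 + p.2.1.1 2 ^ 2)}) ∩
          {p : ℝ × GnoCoord L | p.2.1.1 1 ^ 2 + p.2.1.1 2 ^ 2 ≤ 1 + p.2.1.1 0 ^ 2}).indicator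
        (fun q : ℝ × GnoCoord L => ENNReal.ofReal (Real.exp (-(b * gnoDeficit (fun _ => false) (fun _ => 1) (hubAt q.1 1) ε q.2))))
        (t 0, ((((![t 1, u.1, u.2] : Fin 3 → ℝ), (![t 2, v 0, v 1] : Fin 3 → ℝ)), (z, F)) : GnoCoord L)) ≤
      ENNReal.ofReal (Real.exp (-(b * gnoDeficit (fun _ => false) (fun _ => 1) (hubAt (t 0) 1) ε
        ((((![t 1, u.1, u.2] : Fin 3 → ℝ), (![t 2, v 0, v 1] : Fin 3 → ℝ)), (z, F)) : GnoCoord L)))) :=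
  Set.indicator_le_self _ _ _

end Summit.QuantumFields.YangMills.Theorems.SwapVirialDeficit.SectorLaplace

end
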